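import Mathlib.Analysis.SpecialFunctions.Trigonometric.Bounds
import Mathlib.Analysis.Real.Pi.Bounds
import Mathlib.Analysis.Convex.SpecificFunctions.Deriv
import Literature.Geometry.DiscreteGeometry.CountingSpheresRegularPolygon
import HarnessLib

/-!
# Counting spheres, IV bis: a Lean certificate for the computer inequality (6.111) `[BIEFJHU]`

Companion of `CountingSpheresRegularPolygon.lean`, which states *Dense Sphere Packings*
inequality (6.111) ("by a *computer calculation* [21]", footnote `[BIEFJHU]`, "a linear lower
bound on the area of a regular polygon") as the named fact `HalesDSP_regLowerBound`:
`reg(g(h), k) ≥ 0.591 − 0.0331 k + 0.506 L(h)` for `k = 3, 4, …` and `1 ≤ h ≤ h₀ = 1.26`, with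
`reg(a, k) = 2π − 2k·arcsin(cos a · sin(π/k))`, `g(h) = arccos(h/2) − π/6`,
`L(h) = (h₀ − h)/(h₀ − 1)`.
This file DISCHARGES it (`HalesDSP_regLowerBound_holds`) by a kernel-checked proof from Mathlib's
`3.141592 < π < 3.141593`, `x − x³/6 ≤ sin x`, `|sin x − (x − x³/6)| ≤ |x|⁵/100` and the concavity
of `sin` on `[0, π]`; the remaining arithmetic is on explicit decimals, by `norm_num` (no
`native_decide`, no floating point).  The 9-piece certificate was found by an exact-rational
search (unit `compute-cert-Literature.Geometry.DiscreteGeometry.fly-6b3f0a5b85`, 2026-08-15,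
< 1 core-second) and replaces the Flyspeck interval-arithmetic calculation `[BIEFJHU]`.

## The certificate

Put `c(h) = cos g(h) = (√3 h + √(4 − h²))/4` (`cos_halesDiskRadius`),
`R_k(h) = 0.591 − 0.0331 k + 0.506 L(h)` and `θ_k(h) = (2π − R_k(h))/(2k)` (affine, increasing
in `h`, valued in `[0, π/3]` on `[1, h₀]`).  As `reg(g(h), k) ≥ R_k(h)` iff
`arcsin(c(h)·sin(π/k)) ≤ θ_k(h)`, it suffices that `c(h)·sin(π/k) ≤ sin θ_k(h)`.
* `3 ≤ k ≤ 7`, on a piece `[a, b] ∋ h` with midpoint `m` (`regLowerBound_piece`):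
  `c(h) ≤ (√3 h + (4 − m h)/√(4 − m²))/4` (tangent of the concave `√(4 − ·²)` at `m`;
  `sqrt_four_sub_sq_le_tangent`) `≤ (r h + (4 − m h)/l)/4` for decimals `r ≥ √3`,
  `0 < l ≤ √(4 − m²)`; this is affine in `h` and `sin θ_k` lies above its chord on `[a, b]`, so two
  endpoint inequalities suffice; there `sin θ ≥ 3ψ − 4ψ³`, `ψ = φ − φ³/6`, for a decimal
  `0 ≤ φ ≤ θ/3` (`taylor3_le_sin`: `sin 3t = 3 sin t − 4 sin³ t`, `t − t³/6 ≤ sin t`), and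
  `sin(π/k) ≤ s` (`√3/2`, `√2/2`, `1/2` for `k = 3, 4, 6`; a Taylor bound at `3.141593/k` for
  `k = 5, 7`).  Pieces: `[1, 1.26]` for `k = 3, 4, 7`; `[1, 1.13]`, `[1.13, 1.26]` for `k = 5, 6`;
  least slack `5·10⁻⁴`.
* `k ≥ 8` (`regLowerBound_of_eight_le`): `R_k ≤ R_8 = 0.3262 + 0.506 L(h) ≤ 2π(1 − c(h))` (pieces
  `[1, 1.13]`, `[1.13, 1.26]`, same tangent bound; `regLowerBound_capPiece`) `≤ reg(g(h), k)` by
  the PROVED cap bound `two_pi_mul_one_sub_cos_le_halesReg_halesDiskRadius`.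

## References

* T. C. Hales, *Dense Sphere Packings: A Blueprint for Formal Proofs*, LMS Lecture Note Series
  400, CUP (2012), §6.5, proof of Lemma 6.110, inequality (6.111), calculation `[BIEFJHU]` of the
  Flyspeck archive `[21]` (`HalesDSP2012`).
-/

noncomputable section

namespace Literature.Geometry.DiscreteGeometry

open Real Set

/-! ### Decimal bounds for the constants -/

/-- `√3 ≤ 1.732050808`. [folklore] -/
theorem sqrt_three_le_d9 : √3 ≤ 1.732050808 :=
  ((sqrt_lt' (by norm_num)).2 (by norm_num)).le

/-- `√2 ≤ 1.414213563`. [folklore] -/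
theorem sqrt_two_le_d9 : √2 ≤ 1.414213563 :=
  ((sqrt_lt' (by norm_num)).2 (by norm_num)).le

/-- `sin x ≤ p − p³/6 + p⁵/100` for `−π/2 ≤ x ≤ p`, `0 ≤ p ≤ 1` (monotonicity of `sin` and Mathlib's
`Real.sin_bound`). [folklore] -/
theorem sin_le_taylor_of_le {x p : ℝ} (hx : -(π / 2) ≤ x) (hxp : x ≤ p) (hp0 : 0 ≤ p)
    (hp1 : p ≤ 1) :
    sin x ≤ p - p ^ 3 / 6 + p ^ 5 / 100 := by
  have h1 : sin x ≤ sin p :=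
    sin_le_sin_of_le_of_le_pi_div_two hx (by linarith [pi_gt_three]) hxp
  have h2 := Real.sin_bound (show |p| ≤ 1 by rwa [abs_of_nonneg hp0])
  rw [abs_of_nonneg hp0] at h2
  have h3 := (abs_sub_le_iff.1 h2).1
  linarith

/-- `sin(π/5) ≤ 0.587956148` (Taylor bound at `3.141593/5`). [folklore] -/
theorem sin_pi_div_five_le : sin (π / (5 : ℕ)) ≤ 0.587956148 := by
  rw [Nat.cast_ofNat]
  calc sin (π / 5) ≤ (3.141593 / 5) - (3.141593 / 5) ^ 3 / 6 + (3.141593 / 5) ^ 5 / 100 :=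
        sin_le_taylor_of_le (by linarith [pi_pos]) (by linarith [pi_lt_d6]) (by norm_num)
          (by norm_num)
    _ ≤ 0.587956148 := by norm_num

/-- `sin(π/7) ≤ 0.433914856` (Taylor bound at `3.141593/7`). [folklore] -/
theorem sin_pi_div_seven_le : sin (π / (7 : ℕ)) ≤ 0.433914856 := by
  rw [Nat.cast_ofNat]
  calc sin (π / 7) ≤ (3.141593 / 7) - (3.141593 / 7) ^ 3 / 6 + (3.141593 / 7) ^ 5 / 100 :=
        sin_le_taylor_of_le (by linarith [pi_pos]) (by linarith [pi_lt_d6]) (by norm_num)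
          (by norm_num)
    _ ≤ 0.433914856 := by norm_num

/-! ### The three analytic inequalities behind the certificate -/

/-- **Tangent bound for the concave function `√(4 − h²)`**: for `m² < 4` and `m h ≤ 4`,
`√(4 − h²) ≤ (4 − m h)/√(4 − m²)` (from `(4 − h²)(4 − m²) ≤ (4 − m h)²`, i.e. `0 ≤ 4(m − h)²`).
[folklore] -/
theorem sqrt_four_sub_sq_le_tangent (h m : ℝ) (hm : m ^ 2 < 4) (hmh : m * h ≤ 4) :
    √(4 - h ^ 2) ≤ (4 - m * h) / √(4 - m ^ 2) := by
  have hpos : 0 < √(4 - m ^ 2) := sqrt_pos.2 (by linarith)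
  rw [le_div_iff₀ hpos]
  by_cases hh : 0 ≤ 4 - h ^ 2
  · rw [← sqrt_mul hh]
    calc √((4 - h ^ 2) * (4 - m ^ 2)) ≤ √((4 - m * h) ^ 2) :=
          sqrt_le_sqrt (by nlinarith [sq_nonneg (m - h)])
      _ = 4 - m * h := by rw [sqrt_sq_eq_abs, abs_of_nonneg (by linarith)]
  · rw [sqrt_eq_zero'.2 (le_of_lt (not_le.1 hh)), zero_mul]
    linarith

/-- The resulting affine upper bound for `c(h) = (√3 h + √(4 − h²))/4` with decimal witnesses
`r ≥ √3` and `0 < l ≤ √(4 − m²)`. [folklore] -/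
theorem cos_halesDiskRadius_formula_le_affine {h m l r : ℝ} (hh0 : 0 ≤ h) (hm : m ^ 2 < 4)
    (hmh : m * h ≤ 4) (hl : 0 < l) (hl2 : l ^ 2 ≤ 4 - m ^ 2) (hr : √3 ≤ r) :
    (√3 * h + √(4 - h ^ 2)) / 4 ≤ (r * h + (4 - m * h) / l) / 4 := by
  have h1 : √3 * h ≤ r * h := mul_le_mul_of_nonneg_right hr hh0
  have hlsq : l ≤ √(4 - m ^ 2) := (le_sqrt' hl).2 hl2
  have h2 : √(4 - h ^ 2) ≤ (4 - m * h) / l :=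
    calc √(4 - h ^ 2) ≤ (4 - m * h) / √(4 - m ^ 2) := sqrt_four_sub_sq_le_tangent h m hm hmh
      _ ≤ (4 - m * h) / l := div_le_div_of_nonneg_left (by linarith) hl hlsq
  linarith

/-- **A cubic-Taylor lower bound for `sin` through the triple-angle formula**: for
`0 ≤ φ ≤ 1`, `3φ ≤ x ≤ π/2`, with `ψ = φ − φ³/6`: `3ψ − 4ψ³ ≤ sin x`
(`ψ ≤ sin φ ≤ sin(x/3) ≤ 1/2` and `t ↦ 3t − 4t³` is increasing on `[0, 1/2]`). [folklore] -/
theorem taylor3_le_sin {x φ : ℝ} (hφ0 : 0 ≤ φ) (hφ1 : φ ≤ 1) (hφx : 3 * φ ≤ x) (hx : x ≤ π / 2) :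
    3 * (φ - φ ^ 3 / 6) - 4 * (φ - φ ^ 3 / 6) ^ 3 ≤ sin x := by
  have hsin : sin x = 3 * sin (x / 3) - 4 * sin (x / 3) ^ 3 := by
    rw [← sin_three_mul, show 3 * (x / 3) = x by ring]
  set ψ := φ - φ ^ 3 / 6 with hψ
  set t := sin (x / 3) with ht
  have hφ2 : φ ^ 2 ≤ 1 := pow_le_one₀ hφ0 hφ1
  have hψ0 : 0 ≤ ψ := by
    rw [hψ, show φ - φ ^ 3 / 6 = φ * (1 - φ ^ 2 / 6) by ring]
    exact mul_nonneg hφ0 (by linarith)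
  have hψt : ψ ≤ t := (sin_ge_sub_cube hφ0).trans
    (sin_le_sin_of_le_of_le_pi_div_two (by linarith [pi_pos]) (by linarith [pi_pos]) (by linarith))
  have ht2 : t ≤ 1 / 2 := by
    rw [ht, ← sin_pi_div_six]
    exact sin_le_sin_of_le_of_le_pi_div_two (by linarith [pi_pos]) (by linarith [pi_pos])
      (by linarith)
  have ht0 : 0 ≤ t := hψ0.trans hψt
  have hψ2 : ψ ≤ 1 / 2 := hψt.trans ht2
  have h1 : t * t ≤ 1 / 2 * (1 / 2) := mul_le_mul ht2 ht2 ht0 (by norm_num)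
  have h2 : t * ψ ≤ 1 / 2 * (1 / 2) := mul_le_mul ht2 hψ2 hψ0 (by norm_num)
  have h3 : ψ * ψ ≤ 1 / 2 * (1 / 2) := mul_le_mul hψ2 hψ2 hψ0 (by norm_num)
  have key : 0 ≤ (t - ψ) * (3 - 4 * (t * t + t * ψ + ψ * ψ)) :=
    mul_nonneg (sub_nonneg.2 hψt) (by linarith)
  rw [hsin]
  nlinarith [key]

/-- **Chord bound** (concavity of `sin` on `[0, π]`): for `θa, θb ∈ [0, π]` and `0 ≤ μ ≤ 1`,
`μ sin θa + (1 − μ) sin θb ≤ sin(μ θa + (1 − μ) θb)`. [folklore] -/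
theorem convex_comb_sin_le {θa θb μ : ℝ} (ha0 : 0 ≤ θa) (haπ : θa ≤ π) (hb0 : 0 ≤ θb)
    (hbπ : θb ≤ π) (hμ0 : 0 ≤ μ) (hμ1 : μ ≤ 1) :
    μ * sin θa + (1 - μ) * sin θb ≤ sin (μ * θa + (1 - μ) * θb) := by
  have h := strictConcaveOn_sin_Icc.concaveOn.2 (Set.mem_Icc.2 ⟨ha0, haπ⟩)
    (Set.mem_Icc.2 ⟨hb0, hbπ⟩) hμ0 (by linarith : 0 ≤ 1 - μ) (by ring)
  simpa only [smul_eq_mul] using h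

/-! ### One piece of the certificate for `3 ≤ k ≤ 7` -/

/-- **Piece lemma.**  On `[a, b] ⊆ [1, 1.26]` with midpoint data `m`, witnesses `r ≥ √3`,
`0 < l`, `l² ≤ 4 − m²`, a bound `s ≥ sin(π/k)` and decimals `φa, φb` with
`3φ·2k ≤ 2·3.141592 − R_k` at `a`, `b`: the two endpoint inequalities
`s (r e + (4 − m e)/l)/4 ≤ 3ψ − 4ψ³` (`e = a, b`, `ψ = φ − φ³/6`) give (6.111) for this `k` on
`[a, b]`. [folklore] -/
theorem regLowerBound_piece (k : ℕ) (s r a b m l φa φb : ℝ) (hk : 3 ≤ k) (hs : sin (π / k) ≤ s)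
    (hr : √3 ≤ r) (ha1 : 1 ≤ a) (hab : a < b) (hb : b ≤ 1.26) (hm : m ^ 2 < 4)
    (hmb : m * b ≤ 4) (hm0 : 0 ≤ m) (hl : 0 < l) (hl2 : l ^ 2 ≤ 4 - m ^ 2)
    (hφa0 : 0 ≤ φa) (hφa1 : φa ≤ 1)
    (hφa : 3 * φa * (2 * k) ≤ 2 * 3.141592 - (0.591 - 0.0331 * (k : ℝ) + 0.506 * halesL a))
    (hφb0 : 0 ≤ φb) (hφb1 : φb ≤ 1)
    (hφb : 3 * φb * (2 * k) ≤ 2 * 3.141592 - (0.591 - 0.0331 * (k : ℝ) + 0.506 * halesL b))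
    (hRb : 0 ≤ 0.591 - 0.0331 * (k : ℝ) + 0.506 * halesL b)
    (hA : s * (r * a + (4 - m * a) / l) / 4 ≤ 3 * (φa - φa ^ 3 / 6) - 4 * (φa - φa ^ 3 / 6) ^ 3)
    (hB : s * (r * b + (4 - m * b) / l) / 4 ≤ 3 * (φb - φb ^ 3 / 6) - 4 * (φb - φb ^ 3 / 6) ^ 3)
    {h : ℝ} (hah : a ≤ h) (hhb : h ≤ b) :
    0.591 - 0.0331 * (k : ℝ) + 0.506 * halesL h ≤ halesReg (halesDiskRadius h) k := by
  have hk3 : (3 : ℝ) ≤ k := by exact_mod_cast hk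
  have h2k : (0 : ℝ) < 2 * k := by positivity
  -- the angle `θ_k(t) = (2π − R_k(t))/(2k)`: affine, increasing, `[θ a, θ b] ⊆ [0, π/2]`
  set θ : ℝ → ℝ := fun t => (2 * π - (0.591 - 0.0331 * (k : ℝ) + 0.506 * halesL t)) / (2 * k)
    with hθ
  have hθmono : ∀ {u v : ℝ}, u ≤ v → θ u ≤ θ v := fun {u v} huv => by
    simp only [hθ]
    exact div_le_div_of_nonneg_right (by linarith [halesL_antitone huv]) h2k.le
  have hθa3 : 3 * φa ≤ θ a := by
    simp only [hθ]; rw [le_div_iff₀ h2k]; linarith [pi_gt_d6]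
  have hθb3 : 3 * φb ≤ θ b := by
    simp only [hθ]; rw [le_div_iff₀ h2k]; linarith [pi_gt_d6]
  have hθa0 : 0 ≤ θ a := by linarith
  have hθb2 : θ b ≤ π / 2 := by
    have h1 : θ b ≤ 2 * π / (2 * k) := by
      simp only [hθ]; exact div_le_div_of_nonneg_right (by linarith) h2k.le
    have h2 : 2 * π / (2 * k) ≤ π / 3 := by
      rw [div_le_div_iff₀ h2k (by norm_num : (0:ℝ) < 3)]; nlinarith [pi_pos]
    linarith [pi_pos]
  have hθab : θ a ≤ θ b := hθmono hab.le
  -- convex coordinates of `h` in `[a, b]`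
  have hba : b - a ≠ 0 := (sub_pos.2 hab).ne'
  obtain ⟨μ, hμ0, hμ1, rfl⟩ : ∃ μ : ℝ, 0 ≤ μ ∧ μ ≤ 1 ∧ μ * a + (1 - μ) * b = h :=
    ⟨(b - h) / (b - a), div_nonneg (by linarith) (by linarith),
      (div_le_one (by linarith)).2 (by linarith), by field_simp; ring⟩
  set h := μ * a + (1 - μ) * b with hh
  have hh2 : h ≤ 2 := by linarith
  -- `c(h)` and its affine bound
  have hc : cos (halesDiskRadius h) = (√3 * h + √(4 - h ^ 2)) / 4 :=
    cos_halesDiskRadius (by linarith) hh2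
  have hmh : m * h ≤ 4 := (mul_le_mul_of_nonneg_left hhb hm0).trans hmb
  have hcU : cos (halesDiskRadius h) ≤ (r * h + (4 - m * h) / l) / 4 := by
    rw [hc]; exact cos_halesDiskRadius_formula_le_affine (by linarith) hm hmh hl hl2 hr
  have hc0 : 0 ≤ cos (halesDiskRadius h) := by
    rw [hc]
    exact div_nonneg (add_nonneg (mul_nonneg (sqrt_nonneg _) (by linarith)) (sqrt_nonneg _))
      (by norm_num)
  have hsk0 : 0 ≤ sin (π / k) :=
    sin_nonneg_of_nonneg_of_le_pi (by positivity) (div_le_self pi_pos.le (by linarith))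
  -- the main chain: `c(h)·sin(π/k) ≤ sin θ_k(h)`
  have hx : cos (halesDiskRadius h) * sin (π / k) ≤ sin (θ h) :=
    calc cos (halesDiskRadius h) * sin (π / k) ≤ (r * h + (4 - m * h) / l) / 4 * s :=
          mul_le_mul hcU hs hsk0 (hc0.trans hcU)
      _ = μ * (s * (r * a + (4 - m * a) / l) / 4)
            + (1 - μ) * (s * (r * b + (4 - m * b) / l) / 4) := by
          rw [hh]; ring
      _ ≤ μ * (3 * (φa - φa ^ 3 / 6) - 4 * (φa - φa ^ 3 / 6) ^ 3)
            + (1 - μ) * (3 * (φb - φb ^ 3 / 6) - 4 * (φb - φb ^ 3 / 6) ^ 3) :=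
          add_le_add (mul_le_mul_of_nonneg_left hA hμ0)
            (mul_le_mul_of_nonneg_left hB (by linarith))
      _ ≤ μ * sin (θ a) + (1 - μ) * sin (θ b) :=
          add_le_add
            (mul_le_mul_of_nonneg_left (taylor3_le_sin hφa0 hφa1 hθa3 (hθab.trans hθb2)) hμ0)
            (mul_le_mul_of_nonneg_left (taylor3_le_sin hφb0 hφb1 hθb3 hθb2) (by linarith))
      _ ≤ sin (μ * θ a + (1 - μ) * θ b) :=
          convex_comb_sin_le hθa0 (by linarith [pi_pos]) (hθa0.trans hθab)
            (by linarith [pi_pos]) hμ0 hμ1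
      _ = sin (θ h) := by
          congr 1
          simp only [hθ, halesL_apply, hh]
          ring
  -- conclude: `arcsin x ≤ θ_k(h)`, i.e. `R_k(h) ≤ reg`
  have hθh0 : -(π / 2) ≤ θ h := by linarith [pi_pos, hθmono hah]
  have hθh2 : θ h ≤ π / 2 := (hθmono hhb).trans hθb2
  have harc : arcsin (cos (halesDiskRadius h) * sin (π / k)) ≤ θ h :=
    (arcsin_le_arcsin hx).trans_eq (arcsin_sin hθh0 hθh2)
  have hmul : 2 * k * arcsin (cos (halesDiskRadius h) * sin (π / k))
      ≤ 2 * k * θ h :=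
    mul_le_mul_of_nonneg_left harc h2k.le
  have hkne : (k : ℝ) ≠ 0 := by positivity
  have hθk : 2 * k * θ h = 2 * π - (0.591 - 0.0331 * (k : ℝ) + 0.506 * halesL h) := by
    simp only [hθ]; field_simp
  rw [halesReg_apply]
  linarith

/-! ### The cases `k = 3, …, 7` -/

/-- (6.111) for `k = 3`: one piece; `sin(π/3) = √3/2`. [folklore] -/
theorem regLowerBound_three {h : ℝ} (h1 : 1 ≤ h) (hh0 : h ≤ hales_h0) :
    0.591 - 0.0331 * ((3 : ℕ) : ℝ) + 0.506 * halesL h ≤ halesReg (halesDiskRadius h) 3 := by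
  rw [hales_h0_eq] at hh0
  refine regLowerBound_piece 3 0.866025404 _ 1 1.26 1.13 1.650181808 0.293638 0.32174911
    (by norm_num)
    (by rw [Nat.cast_ofNat, sin_pi_div_three]; linarith [sqrt_three_le_d9]) sqrt_three_le_d9
    ?_ ?_ ?_ ?_ ?_ ?_ ?_ ?_ ?_ ?_ ?_ ?_ ?_ ?_ ?_ ?_ ?_ h1 hh0
  all_goals norm_num [halesL_apply, hales_h0_eq]

/-- (6.111) for `k = 4`: one piece; `sin(π/4) = √2/2`. [folklore] -/
theorem regLowerBound_four {h : ℝ} (h1 : 1 ≤ h) (hh0 : h ≤ hales_h0) :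
    0.591 - 0.0331 * ((4 : ℕ) : ℝ) + 0.506 * halesL h ≤ halesReg (halesDiskRadius h) 4 := by
  rw [hales_h0_eq] at hh0
  refine regLowerBound_piece 4 0.7071067815 _ 1 1.26 1.13 1.650181808 0.22160766 0.242691
    (by norm_num)
    (by rw [Nat.cast_ofNat, sin_pi_div_four]; linarith [sqrt_two_le_d9]) sqrt_three_le_d9
    ?_ ?_ ?_ ?_ ?_ ?_ ?_ ?_ ?_ ?_ ?_ ?_ ?_ ?_ ?_ ?_ ?_ h1 hh0
  all_goals norm_num [halesL_apply, hales_h0_eq]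

/-- (6.111) for `k = 5`: pieces `[1, 1.13]`, `[1.13, 1.26]`; slack `≥ 5·10⁻⁴`. [folklore] -/
theorem regLowerBound_five {h : ℝ} (h1 : 1 ≤ h) (hh0 : h ≤ hales_h0) :
    0.591 - 0.0331 * ((5 : ℕ) : ℝ) + 0.506 * halesL h ≤ halesReg (halesDiskRadius h) 5 := by
  rw [hales_h0_eq] at hh0
  rcases le_total h 1.13 with hA | hA
  · refine regLowerBound_piece 5 _ _ 1 1.13 1.065 1.692860006 0.17838946 0.1868228 (by norm_num)
      sin_pi_div_five_le sqrt_three_le_d9 ?_ ?_ ?_ ?_ ?_ ?_ ?_ ?_ ?_ ?_ ?_ ?_ ?_ ?_ ?_ ?_ ?_ h1 hA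
    all_goals norm_num [halesL_apply, hales_h0_eq]
  · refine regLowerBound_piece 5 _ _ 1.13 1.26 1.195 1.603737821 0.1868228 0.19525613 (by norm_num)
      sin_pi_div_five_le sqrt_three_le_d9 ?_ ?_ ?_ ?_ ?_ ?_ ?_ ?_ ?_ ?_ ?_ ?_ ?_ ?_ ?_ ?_ ?_ hA hh0
    all_goals norm_num [halesL_apply, hales_h0_eq]

/-- (6.111) for `k = 6`: pieces `[1, 1.13]`, `[1.13, 1.26]`; `sin(π/6) = 1/2`; slack `≥ 6·10⁻⁴`.
[folklore] -/
theorem regLowerBound_six {h : ℝ} (h1 : 1 ≤ h) (hh0 : h ≤ hales_h0) :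
    0.591 - 0.0331 * ((6 : ℕ) : ℝ) + 0.506 * halesL h ≤ halesReg (halesDiskRadius h) 6 := by
  rw [hales_h0_eq] at hh0
  have hs : sin (π / (6 : ℕ)) ≤ 0.5 := by rw [Nat.cast_ofNat, sin_pi_div_six]; norm_num
  rcases le_total h 1.13 with hA | hA
  · refine regLowerBound_piece 6 _ _ 1 1.13 1.065 1.692860006 0.14957733 0.15660511 (by norm_num)
      hs sqrt_three_le_d9 ?_ ?_ ?_ ?_ ?_ ?_ ?_ ?_ ?_ ?_ ?_ ?_ ?_ ?_ ?_ ?_ ?_ h1 hA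
    all_goals norm_num [halesL_apply, hales_h0_eq]
  · refine regLowerBound_piece 6 _ _ 1.13 1.26 1.195 1.603737821 0.15660511 0.16363288 (by norm_num)
      hs sqrt_three_le_d9 ?_ ?_ ?_ ?_ ?_ ?_ ?_ ?_ ?_ ?_ ?_ ?_ ?_ ?_ ?_ ?_ ?_ hA hh0
    all_goals norm_num [halesL_apply, hales_h0_eq]

/-- (6.111) for `k = 7`: one piece; slack `≥ 8·10⁻⁴`. [folklore] -/
theorem regLowerBound_seven {h : ℝ} (h1 : 1 ≤ h) (hh0 : h ≤ hales_h0) :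
    0.591 - 0.0331 * ((7 : ℕ) : ℝ) + 0.506 * halesL h ≤ halesReg (halesDiskRadius h) 7 := by
  rw [hales_h0_eq] at hh0
  refine regLowerBound_piece 7 _ _ 1 1.26 1.13 1.650181808 0.12899723 0.14104485 (by norm_num)
    sin_pi_div_seven_le sqrt_three_le_d9 ?_ ?_ ?_ ?_ ?_ ?_ ?_ ?_ ?_ ?_ ?_ ?_ ?_ ?_ ?_ ?_ ?_ h1 hh0
  all_goals norm_num [halesL_apply, hales_h0_eq]

/-! ### The case `k ≥ 8` via the cap bound -/

/-- **Cap piece.**  On `[a, b] ⊆ [1, 1.26]`: the tangent bound for `c(h)` and two endpoint checks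
give `0.3262 + 0.506 L(h) ≤ 2π(1 − cos g(h))`. [folklore] -/
theorem regLowerBound_capPiece (r a b m l : ℝ) (hr : √3 ≤ r) (ha1 : 1 ≤ a) (hab : a < b)
    (hb : b ≤ 1.26)
    (hm : m ^ 2 < 4) (hmb : m * b ≤ 4) (hm0 : 0 ≤ m) (hl : 0 < l) (hl2 : l ^ 2 ≤ 4 - m ^ 2)
    (hUa : (r * a + (4 - m * a) / l) / 4 ≤ 1) (hUb : (r * b + (4 - m * b) / l) / 4 ≤ 1)
    (hA : 0.3262 + 0.506 * halesL a ≤ 2 * 3.141592 * (1 - (r * a + (4 - m * a) / l) / 4))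
    (hB : 0.3262 + 0.506 * halesL b ≤ 2 * 3.141592 * (1 - (r * b + (4 - m * b) / l) / 4))
    {h : ℝ} (hah : a ≤ h) (hhb : h ≤ b) :
    0.3262 + 0.506 * halesL h ≤ 2 * π * (1 - cos (halesDiskRadius h)) := by
  have hba : b - a ≠ 0 := (sub_pos.2 hab).ne'
  obtain ⟨μ, hμ0, hμ1, rfl⟩ : ∃ μ : ℝ, 0 ≤ μ ∧ μ ≤ 1 ∧ μ * a + (1 - μ) * b = h :=
    ⟨(b - h) / (b - a), div_nonneg (by linarith) (by linarith),
      (div_le_one (by linarith)).2 (by linarith), by field_simp; ring⟩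
  set h := μ * a + (1 - μ) * b with hh
  have hh2 : h ≤ 2 := by linarith
  have hc : cos (halesDiskRadius h) = (√3 * h + √(4 - h ^ 2)) / 4 :=
    cos_halesDiskRadius (by linarith) hh2
  have hmh : m * h ≤ 4 := (mul_le_mul_of_nonneg_left hhb hm0).trans hmb
  have hcU : cos (halesDiskRadius h) ≤ (r * h + (4 - m * h) / l) / 4 := by
    rw [hc]; exact cos_halesDiskRadius_formula_le_affine (by linarith) hm hmh hl hl2 hr
  have hUaff : (r * h + (4 - m * h) / l) / 4
      = μ * ((r * a + (4 - m * a) / l) / 4) + (1 - μ) * ((r * b + (4 - m * b) / l) / 4) := by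
    rw [hh]; ring
  have hU1 : (r * h + (4 - m * h) / l) / 4 ≤ 1 := by
    rw [hUaff]; nlinarith
  have hLaff : halesL h = μ * halesL a + (1 - μ) * halesL b := by
    simp only [halesL_apply, hh]; field_simp; ring
  calc 0.3262 + 0.506 * halesL h
        = μ * (0.3262 + 0.506 * halesL a) + (1 - μ) * (0.3262 + 0.506 * halesL b) := by
          rw [hLaff]; ring
    _ ≤ μ * (2 * 3.141592 * (1 - (r * a + (4 - m * a) / l) / 4))
          + (1 - μ) * (2 * 3.141592 * (1 - (r * b + (4 - m * b) / l) / 4)) :=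
          add_le_add (mul_le_mul_of_nonneg_left hA hμ0) (mul_le_mul_of_nonneg_left hB (by linarith))
    _ = 2 * 3.141592 * (1 - (r * h + (4 - m * h) / l) / 4) := by rw [hUaff]; ring
    _ ≤ 2 * π * (1 - (r * h + (4 - m * h) / l) / 4) := by nlinarith [pi_gt_d6]
    _ ≤ 2 * π * (1 - cos (halesDiskRadius h)) := by nlinarith [pi_pos]

/-- (6.111) for `k ≥ 8`: `R_k ≤ R_8 = 0.3262 + 0.506 L ≤ 2π(1 − cos g)` (cap pieces `[1, 1.13]`,
`[1.13, 1.26]`) `≤ reg(g, k)` (the proved cap bound). [folklore] -/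
theorem regLowerBound_of_eight_le {k : ℕ} (hk : 8 ≤ k) {h : ℝ} (h1 : 1 ≤ h) (hh0 : h ≤ hales_h0) :
    0.591 - 0.0331 * (k : ℝ) + 0.506 * halesL h ≤ halesReg (halesDiskRadius h) k := by
  have hcap := two_pi_mul_one_sub_cos_le_halesReg_halesDiskRadius h1 hh0 (k := k) (by omega)
  have h8 : (8 : ℝ) ≤ k := by exact_mod_cast hk
  suffices hmid : 0.3262 + 0.506 * halesL h ≤ 2 * π * (1 - cos (halesDiskRadius h)) by
    linarith
  rw [hales_h0_eq] at hh0
  rcases le_total h 1.13 with hA | hA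
  · refine regLowerBound_capPiece _ 1 1.13 1.065 1.692860006 sqrt_three_le_d9
      ?_ ?_ ?_ ?_ ?_ ?_ ?_ ?_ ?_ ?_ ?_ ?_ h1 hA
    all_goals norm_num [halesL_apply, hales_h0_eq]
  · refine regLowerBound_capPiece _ 1.13 1.26 1.195 1.603737821 sqrt_three_le_d9
      ?_ ?_ ?_ ?_ ?_ ?_ ?_ ?_ ?_ ?_ ?_ ?_ hA hh0
    all_goals norm_num [halesL_apply, hales_h0_eq]

/-! ### Assembly -/

/-- **DSP (6.111) `[BIEFJHU]` holds**: `reg(g(h), k) ≥ 0.591 − 0.0331 k + 0.506 L(h)` for all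
`k ≥ 3` and `1 ≤ h ≤ h₀` — a discharge of the named fact `HalesDSP_regLowerBound` by the certificate
described in the module docstring. [cite: HalesDSP2012, Lemma 6.110 (proof, inequality 6.111)] -/
theorem HalesDSP_regLowerBound_holds : HalesDSP_regLowerBound := by
  intro k hk h h1 hh0
  obtain hk' | hk' : k ≤ 7 ∨ 8 ≤ k := by omega
  · interval_cases k
    · exact regLowerBound_three h1 hh0
    · exact regLowerBound_four h1 hh0
    · exact regLowerBound_five h1 hh0
    · exact regLowerBound_six h1 hh0
    · exact regLowerBound_seven h1 hh0
  · exact regLowerBound_of_eight_le hk' h1 hh0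

end Literature.Geometry.DiscreteGeometry
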